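import Summits.AtomisticToContinuum.BoseEinsteinCondensation.Theses.BECConjugateDomination
import Summits.AtomisticToContinuum.BoseEinsteinCondensation.Theses.BECHardSphereReduction
import Summits.AtomisticToContinuum.BoseEinsteinCondensation.Theses.BECPeriodicReduction
import HarnessLib

/-!
# Crux `HardCoreExtension` (stmt-AtomisticToContinuum-11786) — the two candidate SPLITS, typed and glued
# (route `BECConjugateDomination`; crux-strategist census, 2026-08-17)

`HardCoreExtension := A → B` with `A` = dilute Dirichlet ground-state BEC for every potential of the SMOOTH
class (repulsive finite range, finite, `C²` as `x ↦ v(|x|)`, edge condition `‖D²ṽ‖ ≤ Cₑ√ṽ`) and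
`B = BoseEinsteinCondensation` (the sub-problem conjunct, for EVERY repulsive finite-range `v`).

The strategy census (`Cruxes/HardCoreExtension/STRATEGY-CENSUS.md`) records why every line that starts from
`A` is dead (the antecedent carries no transferable content; kernel-checked: `A → HardCoreDominates →
(HardCoreExtension ↔ HardSphereBEC)`, `…ClosureMap`, and `T★ ↔ PeriodicBEC`, `…NearMinTowerNecessity`).
What remains are two honest DECOMPOSITIONS of the crux into leaf sub-cruxes; this file types both and
proves their glue, so that either can be installed by `ledger route edit … --split HardCoreExtension
--into … --glue-by <decl>` without further Lean work:

* **S2 (antecedent-preserving, the route's own periodic currency).** Children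
  `NonSmoothPeriodicBEC` (torus near-minimiser BEC for every admissible `v` OUTSIDE the smooth class —
  hard cores, hard shells, steps, kinks, integrable spikes) and the route's existing shared crux
  `BoundaryTransferWeak` (stmt-0827). Glue `hardCoreExtension_of_nonSmoothPeriodicBEC` USES `A` for the
  smooth half of the conjunct and the children for the non-smooth half (classical case split on
  membership in the smooth class). `NonSmoothPeriodicBEC` is strictly weaker than
  `BECPeriodicReduction.PeriodicBEC` (stmt-0826) by `nonSmoothPeriodicBEC_of_periodicBEC`.
* **S1 (antecedent idle; reuses the staffed cruxes of route `BECHardSphereReduction`).** Children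
  `HardCoreDominates` (stmt-11884) and `HardSphereBEC` (stmt-11885); glue
  `hardCoreExtension_of_hardCoreDominates_hardSphereBEC` (= the landed
  `…DominationOrderReversal.hardCoreExtension_of_hardSphereReduction`, restated here over the verbatim
  signatures so that `--glue-by` sees the children's statements syntactically).

In both splits the child containing thermodynamic-limit hard-sphere BEC is, modulo `A` (and stmt-11884),
EQUIVALENT to the parent (`…ClosureMap.hardCoreExtension_iff_hardSphereBEC`): the census verdict
"no strategy short of the summit's model case" is exactly this.

References: LSSY2005 §1.2 (1.19), Ch. 5 Thm 5.1 and p. 42 (BEC for genuinely interacting gases open).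
-/

noncomputable section

namespace Summit.AtomisticToContinuum.BoseEinsteinCondensation.Theorems.HardCoreExtensionSplit

open Literature.MathematicalPhysics.QuantumManyBody.BoseGas
open scoped ENNReal
open Summit.AtomisticToContinuum.BoseEinsteinCondensation.Theses

/-! ## S2 — the antecedent-preserving split in the route's periodic currency -/

/-- **S2 child `NonSmoothPeriodicBEC`.** Torus (periodic) near-minimiser BEC at all small densities for
every repulsive finite-range potential that is NOT in the smooth class of the antecedent (i.e. fails one of:
finiteness, `C²` radial profile on `ℝ³`, edge condition `‖D²ṽ‖ ≤ Cₑ√ṽ`): `∃ ρ₀ ∀ ρ<ρ₀ ∃ c ∀ᶠ N ∃ δ`, every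
periodic trial state within `δ` of the periodic ground-state energy has constant-mode occupation `≥ cN`.
This is the per-potential hypothesis of `BoundaryTransferWeak`, quantified over the complement of the
smooth class only; it contains torus BEC for hard spheres (LSSY's open model case). [cite: LSSY2005, Ch. 5 p. 42] -/
def NonSmoothPeriodicBEC : Prop :=
  ∀ v : ℝ → ℝ≥0∞, IsRepulsiveFiniteRange v →
    ¬ ((∀ r, v r ≠ ⊤) ∧ ContDiff ℝ 2 (fun x : Space => (v ‖x‖).toReal) ∧
        ∃ Cₑ : ℝ, ∀ x : Space,
          ‖iteratedFDeriv ℝ 2 (fun x : Space => (v ‖x‖).toReal) x‖ ≤ Cₑ * Real.sqrt ((v ‖x‖).toReal)) →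
    ∃ ρ₀ : ℝ, 0 < ρ₀ ∧ ∀ ρ : ℝ, 0 < ρ → ρ < ρ₀ → ∃ c : ℝ, 0 < c ∧ ∀ᶠ N : ℕ in Filter.atTop,
      ∃ δ : ℝ≥0∞, 0 < δ ∧ ∀ Ψ : PeriodicTrialState N (sideLength ρ N),
        periodicEnergy v Ψ ≤ periodicGroundStateEnergy v N (sideLength ρ N) + δ →
          ENNReal.ofReal (c * N) ≤ condensateOccupation N (sideLength ρ N) Ψ.ψ

/-- **S2 glue (uses the antecedent).** `NonSmoothPeriodicBEC → BoundaryTransferWeak → HardCoreExtension`: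
given `A`, a smooth-class `v` condenses by `A` itself; any other admissible `v` condenses on the torus by
the first child and in the Dirichlet box by the second (stmt-0827). Pure logic (classical case split).
[folklore] -/
theorem hardCoreExtension_of_nonSmoothPeriodicBEC (h₁ : NonSmoothPeriodicBEC)
    (h₂ : BECConjugateDomination.BoundaryTransferWeak) :
    BECConjugateDomination.HardCoreExtension := by
  intro hA v hv
  by_cases hs : ((∀ r, v r ≠ ⊤) ∧ ContDiff ℝ 2 (fun x : Space => (v ‖x‖).toReal) ∧
      ∃ Cₑ : ℝ, ∀ x : Space,
        ‖iteratedFDeriv ℝ 2 (fun x : Space => (v ‖x‖).toReal) x‖ ≤ Cₑ * Real.sqrt ((v ‖x‖).toReal))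
  · exact hA v hv hs.1 hs.2.1 hs.2.2
  · exact h₂ v hv (h₁ v hv hs)

/-- `NonSmoothPeriodicBEC` is a restriction of the periodic conjunct `PeriodicBEC` (stmt-0826): the S2
child is no stronger than the residue `T★ ↔ PeriodicBEC` of the dead line `near-minimiser-slack-transfer`,
and strictly smaller in scope (the smooth class is left to `A`). [folklore] -/
theorem nonSmoothPeriodicBEC_of_periodicBEC (h : BECPeriodicReduction.PeriodicBEC) :
    NonSmoothPeriodicBEC :=
  fun v hv _ => h v hv

/-- Conversely the two halves reassemble the periodic conjunct: `A`'s periodic analogue on the smooth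
class (the route's target `SmoothPeriodicBEC`, stmt-11783, read per potential with `δ` after `N`) together
with `NonSmoothPeriodicBEC` gives `PeriodicBEC`. Recorded to show the split is a partition BY CLASS, not a
weakening of content. [folklore] -/
theorem periodicBEC_of_halves (hS : BECConjugateDomination.SmoothPeriodicBEC)
    (hN : NonSmoothPeriodicBEC) : BECPeriodicReduction.PeriodicBEC := by
  intro v hv
  by_cases hs : ((∀ r, v r ≠ ⊤) ∧ ContDiff ℝ 2 (fun x : Space => (v ‖x‖).toReal) ∧
      ∃ Cₑ : ℝ, ∀ x : Space,
        ‖iteratedFDeriv ℝ 2 (fun x : Space => (v ‖x‖).toReal) x‖ ≤ Cₑ * Real.sqrt ((v ‖x‖).toReal))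
  · exact hS v hv hs.1 hs.2.1 hs.2.2
  · exact hN v hv hs

/-! ## S1 — the antecedent-idle split onto route `BECHardSphereReduction` -/

/-- **S1 glue.** `HardCoreDominates → HardSphereBEC → HardCoreExtension`, with the children written as the
verbatim statements of stmt-11884 / stmt-11885 (so that a `--split … --glue-by` sees them syntactically);
the proof is route `BECHardSphereReduction`'s deciding theorem with `A` discarded — the kernel-checked form
of "with `A` idle the crux is downstream of the hard-sphere reduction". [cite: LSSY2005, Ch. 5 p. 42] -/
theorem hardCoreExtension_of_hardCoreDominates_hardSphereBEC
    (h₁ : ∀ (v : ℝ → ℝ≥0∞) (R : ℝ), Measurable v → 0 < R → (∀ r : ℝ, R < r → v r = 0) →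
      ∃ η₀ : ℝ, 0 < η₀ ∧ ∀ (N : ℕ) (L : ℝ), (N : ℝ) * R ^ 3 ≤ η₀ * L ^ 3 →
        condensateNumber (Set.indicator (Set.Iic R) (fun _ : ℝ => (⊤ : ℝ≥0∞))) N L ≤
          condensateNumber v N L)
    (h₂ : ∀ a : ℝ, 0 < a → ∃ ρ₀ : ℝ, 0 < ρ₀ ∧ ∀ ρ : ℝ, 0 < ρ → ρ < ρ₀ →
      HasGroundStateBEC (Set.indicator (Set.Iic a) (fun _ : ℝ => (⊤ : ℝ≥0∞))) ρ) :
    BECConjugateDomination.HardCoreExtension :=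
  fun _ => BECHardSphereReduction.closes h₁ h₂

end Summit.AtomisticToContinuum.BoseEinsteinCondensation.Theorems.HardCoreExtensionSplit

end
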